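import Literature.NumberTheory.EllipticCurves.H1CorestrictionIndexTwo
import Literature.NumberTheory.EllipticCurves.PeriodIndexCorestriction
import HarnessLib

/-!
# The index-`2` corestriction `corH1` IS the general corestriction `coresH1` (transversal `{1, c}`)

Generic continuous group cohomology (no number theory), on the tree's model
`Literature.NumberTheory.EllipticCurves.discreteH1` of `H¹_cont`.  The tree carries TWO corestrictions
along an open subgroup `N ≤ G` of finite index on `H¹_cont`:

* `corH1 hN hM hc : H¹(N, M) → H¹(G, M)` of `H1CorestrictionIndexTwo.lean` — for `N` NORMAL OF INDEX `2`,
  `G = N ⊔ N c` (`hc : ∀ b, Xor (b c⁻¹ ∈ N) (b ∈ N)`), by the explicit transfer `F(n) = f(n) + c • f(c⁻¹ n c)`,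
  `F(n c) = F(n) + n • f(c²)`; this is the `cor` under `corBaseChange` (`ShaCorestrictionIndexTwo.lean`,
  quadratic `K/ℚ`) and the Cassels–Tate res/cor packages;
* `coresH1 N hN : H¹(N, M) → H¹(G, M)` of `PeriodIndexCorestriction.lean` — for ANY open subgroup of finite
  index, by the transfer `(cor f)(g) = Σ_{x ∈ G/N} s(g • x) • f(s(g • x)⁻¹ g s(x))` over a system `s` of left coset
  representatives (independent of `s`, `coresH1With_eq_coresH1`); this is the `cores` of Clark–Sharif's local
  triviality / double-coset formula (`PeriodIndexCorestrictionLocal.lean`, `resH1Hom_coresH1_eq_zero`).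

This file proves they AGREE (`corH1_eq_coresH1`): with the transversal `s(N) = 1`, `s(cN) = c` the two transfers
coincide ON COCYCLES (`corFun_eq_coresFun`).  Consequence: every `coresH1`-theorem (double cosets, local
triviality, change of coefficients) applies verbatim to the index-`2` `corH1`, in particular to `corBaseChange`.
Everything here is proved; no definition, no named fact, no instance, no `sorry`.

## References

* J.-P. Serre, *Galois Cohomology* (1997), I.§2.4 (Res, Cor); *Local Fields* (1979), VII.§7–§8 (the transfer on
  inhomogeneous cochains and its independence of the transversal). [SerreGaloisCohomology1997] [SerreLocalFields1979]
* J. Neukirch, A. Schmidt, K. Wingberg, *Cohomology of Number Fields*, 2nd ed. (2008), I.§5.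
  [NeukirchSchmidtWingberg2008]
-/

noncomputable section

open scoped Classical

universe u

namespace Literature.NumberTheory.EllipticCurves

open GaloisRepresentations

variable {G : Type u} [Group G] [TopologicalSpace G] [IsTopologicalGroup G]
variable {N : Subgroup G} [N.Normal] {c : G}
variable {M : Type u} [AddCommGroup M] [DistribMulAction G M] [TopologicalSpace M] [DiscreteTopology M]

/-! ## The transversal `{1, c}` of an index-`2` subgroup -/

omit [TopologicalSpace G] [IsTopologicalGroup G] in
/-- For `n ∈ N` (`N` normal): `(n c) N = c N` in `G ⧸ N` (Serre, *Local Fields*, VII.§8: cosets of a normal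
subgroup). [cite: SerreLocalFields1979, VII.§8] -/
theorem coe_subgroup_mul_eq_coe (n : N) : (((n : G) * c : G) : G ⧸ N) = (c : G ⧸ N) := by
  rw [QuotientGroup.eq, mul_inv_rev]
  have h := ‹N.Normal›.conj_mem _ (N.inv_mem n.2) c⁻¹
  rwa [inv_inv] at h

omit [TopologicalSpace G] [IsTopologicalGroup G] in
/-- For `G = N ⊔ N c`: `c N ≠ 1` in `G ⧸ N`. [cite: SerreLocalFields1979, VII.§8] -/
theorem coe_ne_one_of_xor (hc : ∀ b : G, Xor (b * c⁻¹ ∈ N) (b ∈ N)) : (c : G ⧸ N) ≠ 1 :=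
  fun h ↦ not_mem_of_xor hc ((QuotientGroup.eq_one_iff c).mp h)

omit [TopologicalSpace G] [IsTopologicalGroup G] in
/-- For `G = N ⊔ N c`: every coset is `N` or `c N` (the transversal `{1, c}` of an index-`2` subgroup).
[cite: SerreLocalFields1979, VII.§8] -/
theorem coe_eq_one_or_eq_of_xor (hc : ∀ b : G, Xor (b * c⁻¹ ∈ N) (b ∈ N)) (x : G ⧸ N) :
    x = 1 ∨ x = (c : G ⧸ N) := by
  induction x using QuotientGroup.induction_on with
  | H g =>
    rcases exists_eq_or_eq_mul hc g with ⟨n, rfl⟩ | ⟨n, rfl⟩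
    · exact Or.inl ((QuotientGroup.eq_one_iff _).mpr n.2)
    · exact Or.inr (coe_subgroup_mul_eq_coe n)

omit [TopologicalSpace G] [IsTopologicalGroup G] in
/-- **The transversal `{1, c}`**: `s(N) = 1`, `s(x) = c` otherwise, is a system of left coset representatives
of the index-`2` subgroup `N` (`s(x) N = x`). Serre, *Local Fields*, VII.§8 (systems of representatives for the
transfer). [cite: SerreLocalFields1979, VII.§8] -/
theorem indexTwoSection_spec (hc : ∀ b : G, Xor (b * c⁻¹ ∈ N) (b ∈ N)) (x : G ⧸ N) :
    (((fun y : G ⧸ N ↦ if y = 1 then (1 : G) else c) x : G) : G ⧸ N) = x := by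
  rcases coe_eq_one_or_eq_of_xor hc x with rfl | rfl
  · simp
  · simp [coe_ne_one_of_xor hc]

/-! ## The two transfers agree on cocycles -/

omit [IsTopologicalGroup G] [N.Normal] in
/-- Values of a cocycle on `N` only depend on the underlying element of `G`. [folklore] -/
private theorem cocycle_congr (f : contOneCocycles (discreteTopRep N M)) {a b : N} (h : (a : G) = b) :
    f.1 a = f.1 b := by
  rw [Subtype.ext h]

/-- **The index-`2` transfer is the general transfer for the transversal `{1, c}`**: for every continuous
crossed homomorphism `f : N → M` and every `g ∈ G`,
`corFun hc f g = Σ_{x ∈ G/N} s(g • x) • f(s(g • x)⁻¹ g s(x))` with `s(N) = 1`, `s(cN) = c`.  On `g = n ∈ N` the two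
summands are `f(n)` (at `x = N`) and `c • f(c⁻¹ n c)` (at `x = cN`); on `g = n c` they are `c • f(c⁻¹ n c)` (at
`x = N`, since `n c N = c N`) and `f(n c²) = f(n) + n • f(c²)` (at `x = c N`, since `n c · c N = N`).
Neukirch–Schmidt–Wingberg, I.§5 (cor on inhomogeneous cochains); Serre, *Local Fields*, VII.§8.
[cite: NeukirchSchmidtWingberg2008, I.§5] [cite: SerreLocalFields1979, VII.§8] -/
theorem corFun_eq_coresFun [Fintype (G ⧸ N)] (hc : ∀ b : G, Xor (b * c⁻¹ ∈ N) (b ∈ N))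
    (f : contOneCocycles (discreteTopRep N M)) (g : G) :
    corFun hc f g = coresFun N (s := fun y : G ⧸ N ↦ if y = 1 then (1 : G) else c)
      (indexTwoSection_spec hc) f g := by
  set s : G ⧸ N → G := fun y : G ⧸ N ↦ if y = 1 then (1 : G) else c with hs_def
  have hs1 : s 1 = 1 := by simp [hs_def]
  have hsc : s (c : G ⧸ N) = c := by simp [hs_def, coe_ne_one_of_xor hc]
  have hne : (1 : G ⧸ N) ≠ (c : G ⧸ N) := (coe_ne_one_of_xor hc).symm
  rw [coresFun_apply, Fintype.sum_eq_add (1 : G ⧸ N) (c : G ⧸ N) hne (fun x hx ↦ by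
    rcases coe_eq_one_or_eq_of_xor hc x with rfl | rfl
    · exact absurd rfl hx.1
    · exact absurd rfl hx.2)]
  rcases exists_eq_or_eq_mul hc g with ⟨n, rfl⟩ | ⟨n, rfl⟩
  · -- `g = n ∈ N`: `n • N = N`, `n • cN = cN`
    have h1 : (n : G) • (1 : G ⧸ N) = 1 := by
      rw [← QuotientGroup.mk_one, MulAction.Quotient.smul_coe, smul_eq_mul, mul_one]
      exact (QuotientGroup.eq_one_iff _).mpr n.2
    have h2 : (n : G) • (c : G ⧸ N) = (c : G ⧸ N) := by
      rw [MulAction.Quotient.smul_coe, smul_eq_mul]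
      exact coe_subgroup_mul_eq_coe n
    have e1 : f.1 (schreierElt N (indexTwoSection_spec hc) (n : G) 1) = f.1 n :=
      cocycle_congr f (by rw [schreierElt_coe]; change (s ((n : G) • (1 : G ⧸ N)))⁻¹ * n * s 1 = n;
                          rw [h1, hs1, inv_one, one_mul, mul_one])
    have e2 : f.1 (schreierElt N (indexTwoSection_spec hc) (n : G) (c : G ⧸ N)) = f.1 (subgroupConj N c n) :=
      cocycle_congr f (by rw [schreierElt_coe, subgroupConj_apply_coe];
                          change (s ((n : G) • (c : G ⧸ N)))⁻¹ * n * s (c : G ⧸ N) = c⁻¹ * n * c; rw [h2, hsc])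
    rw [corFun_coe, symCocycle_apply, e1, e2, h1, h2, if_pos rfl, if_neg (coe_ne_one_of_xor hc), one_smul]
  · -- `g = n c`: `n c • N = c N`, `n c • cN = N`
    have h1 : ((n : G) * c) • (1 : G ⧸ N) = (c : G ⧸ N) := by
      rw [← QuotientGroup.mk_one, MulAction.Quotient.smul_coe, smul_eq_mul, mul_one]
      exact coe_subgroup_mul_eq_coe n
    have h2 : ((n : G) * c) • (c : G ⧸ N) = 1 := by
      rw [MulAction.Quotient.smul_coe, smul_eq_mul, mul_assoc]
      exact (QuotientGroup.eq_one_iff _).mpr (N.mul_mem n.2 (mul_self_mem_of_xor hc))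
    have e1 : f.1 (schreierElt N (indexTwoSection_spec hc) ((n : G) * c) 1) = f.1 (subgroupConj N c n) :=
      cocycle_congr f (by rw [schreierElt_coe, subgroupConj_apply_coe];
                          change (s (((n : G) * c) • (1 : G ⧸ N)))⁻¹ * (n * c) * s 1 = c⁻¹ * n * c;
                          rw [h1, hsc, hs1, mul_one, mul_assoc])
    have e2 : f.1 (schreierElt N (indexTwoSection_spec hc) ((n : G) * c) (c : G ⧸ N)) = f.1 (n * cSq hc) :=
      cocycle_congr f (by rw [schreierElt_coe, Subgroup.coe_mul, cSq_coe];
                          change (s (((n : G) * c) • (c : G ⧸ N)))⁻¹ * (n * c) * s (c : G ⧸ N) = n * (c * c);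
                          rw [h2, hs1, hsc, inv_one, one_mul, mul_assoc])
    rw [corFun_coe_mul, symCocycle_apply, e1, e2, cocycle_mul, h1, h2, if_neg (coe_ne_one_of_xor hc), if_pos rfl,
      one_smul]
    abel

/-! ## `corH1 = coresH1` -/

/-- **The index-`2` corestriction `corH1` of `H1CorestrictionIndexTwo.lean` equals the general corestriction
`coresH1` of `PeriodIndexCorestriction.lean`** (as maps `H¹(N, M) → H¹(G, M)`), for an open normal subgroup `N`
of index `2`, `G = N ⊔ N c`: on cocycles the two transfers agree for the transversal `{1, c}`
(`corFun_eq_coresFun`), and `coresH1` does not depend on the transversal (`coresH1_oneCocycleClass`).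
Serre, *Galois Cohomology*, I.§2.4 (the corestriction is canonical); *Local Fields*, VII.§7–§8 (independence of
the transversal). [cite: SerreGaloisCohomology1997, I.§2.4] [cite: SerreLocalFields1979, VII.§8] -/
theorem corH1_eq_coresH1 [Fintype (G ⧸ N)] (hN : IsOpen (N : Set G))
    (hM : ∀ m : M, Continuous fun g : G ↦ g • m) (hc : ∀ b : G, Xor (b * c⁻¹ ∈ N) (b ∈ N)) :
    corH1 (M := M) hN hM hc = coresH1 N hN := by
  ext ξ
  obtain ⟨f, rfl⟩ := oneCocycleClass_surjective _ ξ
  rw [corH1_oneCocycleClass, coresH1_oneCocycleClass N hN (indexTwoSection_spec hc)]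
  congr 1
  apply Subtype.ext
  ext g
  rw [corCocycle_apply, coresCocycle_apply]
  exact corFun_eq_coresFun hc f g

/-- Pointwise form of `corH1_eq_coresH1`. [cite: SerreGaloisCohomology1997, I.§2.4] -/
theorem corH1_apply_eq_coresH1 [Fintype (G ⧸ N)] (hN : IsOpen (N : Set G))
    (hM : ∀ m : M, Continuous fun g : G ↦ g • m) (hc : ∀ b : G, Xor (b * c⁻¹ ∈ N) (b ∈ N))
    (ξ : subgroupH1 N M) : corH1 hN hM hc ξ = coresH1 N hN ξ := by
  rw [corH1_eq_coresH1]

end Literature.NumberTheory.EllipticCurves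

end
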